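/- Copyright: ym3-torus cell, WIDTH-5 ATTACH seat `ym-ust-19936-w4` (prover, g11), for crux `HistoryTailL` (stmt-QuantumFields-19936),
line «local_insertion», height one: (EQ1) in the consumer's letters, UNCONDITIONALLY, and the knit «height one ⟸ K1».
Released under the licence of the surrounding project. -/
import Summits.QuantumFields.YangMills.Theorems.LocalInsertionGoodHeightOne
import Summits.QuantumFields.YangMills.Theorems.LocalInsertionExpMomentSU2TorusUniformT3
import Summits.QuantumFields.YangMills.Theorems.LocalInsertionSublevelDoublingOneSitePartition
import HarnessLib

/-!
# Line «local_insertion» on crux `HistoryTailL` (stmt-QuantumFields-19936) — HEIGHT ONE ⟸ K1 ALONE, UNCONDITIONALLY IN EVERYTHING ELSE: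
# (EQ1) «`∫ dist1 U(∂p) ∂Gibbs_K ≤ C₁·√(γL^{−K})`» in the consumer's letters from the β-UNIFORM mean plaquette deviation and the d = 3 one-site
# doubling (both in the tree), and the knit

Cell `ym3-torus` (YM ladder rung R3 = continuum SU(2) Yang–Mills on the three-torus — a RUNG, NOT the Clay problem: not d = 4, not
infinite volume, not a mass gap), width seat `ym-ust-19936-w4` gen 11, `--supports stmt-QuantumFields-19936 --as helper`.  THEOREMS ONLY,
definition-free.

After ✓`GoodHeightOne.insertionHeightOneInterior_of_concentration_meanPlaquette'` (GOOD-1 discharged) the registered stub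
`stub_insertionHeightOne` of `Cruxes/HistoryTailL/Lines/local_insertion.lean` at the interior cut-offs `K ≥ 3` rests on K1
(`Theses.PoincareLipschitz.MesoscopicConcentrationL`, stmt-23532) and (EQ1).  THIS FILE reads (EQ1) — in EXACTLY the consumer's letters
`∀ L, ∃ C₁ ≥ 0, ∃ γ₁ ∈ (0,1], ∀ F γ, F.L = L → 0 < γ ≤ γ₁ → ∀ K p, ∫ dist1 U(∂p) ∂(gibbsK F ℰp γ K) ≤ C₁·√(γ·L^{−K})` — off ★w4 g10's β-UNIFORM
mean plaquette deviation ✓`ExpMomentSU2UniformT3.exists_integral_dist1_gibbsK_le_uniform` (`∫ dist1 ≤ C∕√β_K` once `β_K ≥ 8`; TRUE Gaussian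
scale, no `√log β` loss, no `β^{c∕n}` residual): `β_K = (γL^{−K})⁻¹ ≥ γ⁻¹ ≥ 8` for `γ ≤ γ₁ := 1∕8`, and `C∕√β_K = C·√(γL^{−K})` (§1
★★`meanPlaquette_uniform_of_oneSiteDoubling (hONE)`, modulo the displayed d = 3 one-site doubling `hONE : ∃ K, ∀ t > 0, Z₁(t∕4) ≤ K·Z₁(t)`,
`Z₁ = partitionFunction (d := 3) (L := 1) (fundamentalRep (Fin 2))` — the single displayed hypothesis of ★w4 g10's level-0-uniform chain), then
§2 ★★`meanPlaquette_uniform` UNCONDITIONAL: `hONE` is ★w7 g10's (T4-SUB) port ✓`LocalInsertion.SublevelDoubling.oneSite_partitionFunction_doubling_su2_d3`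
(`Theorems/LocalInsertionSublevelDoublingOneSitePartition.lean`, LETTER-EXACT), and §3 ★★★`insertionHeightOneInterior_of_concentration (hK1)`:
«HEIGHT ONE (interior `K ≥ 3`) ⟸ K1», i.e. ★w3 g11's ✓`insertionHeightOneInterior_of_concentration_meanPlaquette` with (EQ1) AND GOOD-1 both
DISCHARGED by theorems of the tree — the registered stub `stub_insertionHeightOne` of line «local_insertion» at the cut-offs `K ≥ 3` now rests,
by kernel, on `Theses.PoincareLipschitz.MesoscopicConcentrationL` (stmt-23532) ALONE.

HONEST FRAMING.  Dictionary ∕ knit over tree theorems.  §3 is CONDITIONAL on K1 (23532, organ-class: mesoscopic Poincaré-scale concentration at all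
scales `17L³ < n ≤ β_K` — NOT in the tree, NOT in print for weakly coupled non-abelian gauge fields).  Nothing of `LocalInsertionL` (23607), the
registered stubs, the crux `HistoryTailL`, K1, d = 4, a continuum limit or a mass gap is proved.  YM₃ on T³ is rung R3, NOT the Clay problem.

References: T. Bałaban, CMP **102** (1985) 255–275 [Balaban1985UV3] ((3) p.256, (7) p.257, (71) p.273); S. Chatterjee, CMP 2016
[Chatterjee2016] (free-energy sandwich mechanism behind the β-uniform moment).
-/

set_option autoImplicit false

noncomputable section

open scoped BigOperators
open MeasureTheory
open Literature.MathematicalPhysics.QuantumFieldTheory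
open Literature.MathematicalPhysics.QuantumFieldTheory.Balaban1983to89
open Literature.MathematicalPhysics.QuantumFieldTheory.Balaban1983to89.T3ContinuumYM3Torus
open Literature.MathematicalPhysics.QuantumFieldTheory.Balaban1983to89.T3UnitScaleTilt
open Literature.MathematicalPhysics.QuantumFieldTheory.Balaban1983to89.T3UnitLawDensityEML
open Literature.MathematicalPhysics.QuantumFieldTheory.Balaban1983to89.T3UpperLiftSplit (scheme_β_eq)
open Literature.MathematicalPhysics.QuantumLattice (fundamentalRep)
open Summit.QuantumFields.YangMills.Theorems.LocalInsertion.ExpMomentSU2UniformT3 (exists_integral_dist1_gibbsK_le_uniform)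
open Summit.QuantumFields.YangMills.Theorems.LocalInsertion.GoodHeightOne (insertionHeightOneInterior_of_concentration_meanPlaquette')
open Summit.QuantumFields.YangMills.Theorems.LocalInsertion.SublevelDoubling (oneSite_partitionFunction_doubling_su2_d3)

namespace Summit.QuantumFields.YangMills.Theorems.LocalInsertion.HeightOneOfConcentration

/-! ## §1 (EQ1) in the consumer's letters, modulo the one-site doubling -/

/-- **(EQ1) — THE MEAN BARE PLAQUETTE DEVIATION AT THE GAUSSIAN SCALE, IN THE CONSUMER'S LETTERS, modulo the one-site doubling.**
`hONE → ∀ L, ∃ C₁ ≥ 0, ∃ γ₁ ∈ (0,1], ∀ F γ, F.L = L → 0 < γ ≤ γ₁ → ∀ K p, ∫ dist1 U(∂p) ∂Gibbs_K ≤ C₁·√(γL^{−K})` (`γ₁ = 1∕8`,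
`C₁ = max C 0` with ✓`exists_integral_dist1_gibbsK_le_uniform`'s `C`; `β_K = (γL^{−K})⁻¹ ≥ 8`, `C∕√β_K = C·√(γL^{−K})`).  This is the `hEQ1`
hypothesis of ✓`GoodHeightOne.insertionHeightOneInterior_of_concentration_meanPlaquette'` VERBATIM.  CONDITIONAL on `hONE` only.
[cite: Balaban1985UV3, (3) p.256 and (71) p.273] -/
theorem meanPlaquette_uniform_of_oneSiteDoubling
    (hONE : ∃ K : ℝ, ∀ t : ℝ, 0 < t →
      (partitionFunction (d := 3) (L := 1) (fundamentalRep (Fin 2)) (t / 4)).toReal ≤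
        K * (partitionFunction (d := 3) (L := 1) (fundamentalRep (Fin 2)) t).toReal) :
    ∀ (L : ℕ), ∃ C₁ : ℝ, 0 ≤ C₁ ∧ ∃ γ₁ : ℝ, 0 < γ₁ ∧ γ₁ ≤ 1 ∧ ∀ (F : T3Family) (γ : ℝ), F.L = L → 0 < γ → γ ≤ γ₁ →
      ∀ (K : ℕ) (p : Plaq (F.P K) 0),
        ∫ U, GaugeGroup.dist1 (GaugeField.plaqHol U p) ∂(gibbsK F ℰp γ K) ≤ C₁ * Real.sqrt (γ * ((F.L : ℝ)⁻¹) ^ K) := by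
  intro L
  obtain ⟨C, hC⟩ := exists_integral_dist1_gibbsK_le_uniform hONE
  refine ⟨max C 0, le_max_right _ _, 1 / 8, by norm_num, by norm_num, fun F γ _ hγ hγle K p => ?_⟩
  -- `x = γ L^{-K} ∈ (0, 1/8]`, `β_K = x⁻¹ ≥ 8`
  set x : ℝ := γ * ((F.L : ℝ)⁻¹) ^ K with hx
  have hL1 : (1 : ℝ) ≤ F.L := by exact_mod_cast F.hL.2.le
  have hx0 : 0 < x := by positivity
  have hxγ : x ≤ γ := by
    have h1 : ((F.L : ℝ)⁻¹) ^ K ≤ 1 := pow_le_one₀ (by positivity) (inv_le_one_of_one_le₀ hL1)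
    calc x = γ * ((F.L : ℝ)⁻¹) ^ K := rfl
      _ ≤ γ * 1 := mul_le_mul_of_nonneg_left h1 hγ.le
      _ = γ := mul_one _
  have hβeq : (F.scheme ℰp γ).β K = x⁻¹ := scheme_β_eq F γ K
  have hβ8 : 8 ≤ (F.scheme ℰp γ).β K := by
    rw [hβeq]
    exact le_inv_of_le_inv₀ hx0 (by linarith)
  have h := hC F ℰp γ K hβ8 p
  rw [hβeq, Real.sqrt_inv, div_inv_eq_mul] at h
  exact h.trans (mul_le_mul_of_nonneg_right (le_max_left _ _) (Real.sqrt_nonneg _))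

/-! ## §2 (EQ1) unconditionally -/

/-- **(EQ1) — THE MEAN BARE PLAQUETTE DEVIATION AT THE GAUSSIAN SCALE, IN THE CONSUMER'S LETTERS, UNCONDITIONALLY.**
`∀ L, ∃ C₁ ≥ 0, ∃ γ₁ ∈ (0,1], ∀ F γ, F.L = L → 0 < γ ≤ γ₁ → ∀ K p, ∫ dist1 U(∂p) ∂Gibbs_K ≤ C₁·√(γL^{−K})`: §1 with `hONE` discharged by ★w7 g10's
✓`SublevelDoubling.oneSite_partitionFunction_doubling_su2_d3` (the d = 3 one-site doubling, (T4-SUB) chain).  The `hEQ1` hypothesis of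
✓`GoodHeightOne.insertionHeightOneInterior_of_concentration_meanPlaquette'` VERBATIM; TRUE Gaussian scale, γ- and volume-free constants (in fact
`C₁`, `γ₁` do not depend on `L` either).  Level-0 lane of line «local_insertion» (T1–T4, ★w7∕★w4 g9–g11) end to end. [cite: Balaban1985UV3, (3) p.256 and (71) p.273] -/
theorem meanPlaquette_uniform :
    ∀ (L : ℕ), ∃ C₁ : ℝ, 0 ≤ C₁ ∧ ∃ γ₁ : ℝ, 0 < γ₁ ∧ γ₁ ≤ 1 ∧ ∀ (F : T3Family) (γ : ℝ), F.L = L → 0 < γ → γ ≤ γ₁ →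
      ∀ (K : ℕ) (p : Plaq (F.P K) 0),
        ∫ U, GaugeGroup.dist1 (GaugeField.plaqHol U p) ∂(gibbsK F ℰp γ K) ≤ C₁ * Real.sqrt (γ * ((F.L : ℝ)⁻¹) ^ K) :=
  meanPlaquette_uniform_of_oneSiteDoubling oneSite_partitionFunction_doubling_su2_d3

/-! ## §3 Height one ⟸ K1 alone -/

/-- **HEIGHT ONE FROM K1 ALONE.**  ★w3 g11's ✓`insertionHeightOneInterior_of_concentration_meanPlaquette` with BOTH elementary rows supplied by
theorems of the tree: GOOD-1 by ✓`GoodHeightOne.good_heightOne` and (EQ1) by §2 `meanPlaquette_uniform`.  For every `L`, `ε ≥ 0`, `b₀ > 0`,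
`p₀ > 2`: a `K`-, plaquette-uniform `M₀` and `γ₁` with `∫_{G(a,1)} exp(ε·min(dist1(Ū¹(∂a))∕g_{K−1}, p(g_{K−1}))) ∂Gibbs_K ≤ M₀` at `j = 1`,
`j + 2 ≤ K` — the registered stub `stub_insertionHeightOne` of `Cruxes/HistoryTailL/Lines/local_insertion.lean` at the interior cut-offs
`K ≥ 3` (its `K ∈ {1, 2}` instances are outside K1's box as typed).  CONDITIONAL on K1 (stmt-23532) ONLY; nothing of K1, `LocalInsertionL`, the
stubs or the crux is proved. [cite: Balaban1985UV3, (7) p.257 and (71) p.273] -/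
theorem insertionHeightOneInterior_of_concentration
    (hK1 : Summit.QuantumFields.YangMills.Theses.PoincareLipschitz.MesoscopicConcentrationL) :
    ∀ (L : ℕ) (ε : ℝ), 0 ≤ ε → ∀ (b₀ p₀ : ℝ), 0 < b₀ → 2 < p₀ → ∃ M₀ : ℝ, 0 ≤ M₀ ∧ ∃ γ₁ : ℝ, 0 < γ₁ ∧ γ₁ ≤ 1 ∧ ∀ (F : T3Family) (γ : ℝ), F.L = L → 0 < γ → γ ≤ γ₁ → ∀ (K j : ℕ), 1 ≤ j → j + 2 ≤ K → j ≤ 1 → ∀ (a : Plaq (F.P K) j), ∫ U in {U : GaugeField (F.P K) 0 (Matrix.specialUnitaryGroup (Fin 2) ℂ) | (∀ (i : ℕ) (q : Plaq (F.P K) i), i < j → Site.tdist (fun k => ((((q.src k).val * F.L ^ i : ℕ)) : ZMod ((F.P K).sitesPerDir 0))) (fun k => ((((a.src k).val * F.L ^ j : ℕ)) : ZMod ((F.P K).sitesPerDir 0))) + 64 * F.L ^ i ≤ 64 * F.L ^ j → GaugeGroup.dist1 (GaugeField.plaqHol (Averaging.iter (fun i' => BlockAveraging.blockAvg (P := F.P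 K) (j := i') ℰp) i U) q) < θBal F.L γ b₀ p₀ (K - i))}, Real.exp (ε * min (GaugeGroup.dist1 (GaugeField.plaqHol (Averaging.iter (fun i' => BlockAveraging.blockAvg (P := F.P K) (j := i') ℰp) j U) a) / Real.sqrt (γ * ((F.L : ℝ)⁻¹) ^ (K - j))) (B10.pFun b₀ p₀ (Real.sqrt (γ * ((F.L : ℝ)⁻¹) ^ (K - j))))) ∂(gibbsK F ℰp γ K) ≤ M₀ :=
  insertionHeightOneInterior_of_concentration_meanPlaquette' hK1 meanPlaquette_uniform

end Summit.QuantumFields.YangMills.Theorems.LocalInsertion.HeightOneOfConcentration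

end
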